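import Summits.Ventures.LatticeQCDFlow.Exactness.IMHCommonRandomNumbersMeetingTimeMGF
import Summits.Ventures.LatticeQCDFlow.Exactness.IMHCommonRandomNumbersMeetingTimeTotal
import HarnessLib

/-!
# The law of the meeting time, completed: `P(T ≥ t) = P(X_{t−1} ≠ X′_{t−1})` EXACTLY from every initial coupling, the
# `M = ∞` exponential moments `E[s^T] ≤ 1 + (s − 1)·P(X_0 ≠ X′_0)/(1 − s(1 − A))` for `1 ≤ s < 1/(1 − A)`, and from
# (cold, off-mode) `T` IS geometric: `P(T ≥ t) = (1 − A)^{t−1}`, `E[s^T] = sA/(1 − s(1 − A))`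

HONEST FRAMING: exact (Metropolis-corrected) sampling algorithms for lattice gauge theory;
figures of merit are autocorrelation/cost numbers at stated couplings and volumes; no
continuum-physics claim.

Venture `LatticeQCDFlow` (cell pub-lqcd), topic `Exactness`; FANOUT row 30 (lean-1, GEN-39).  NEW WORK of the cell,
general state space with `MeasurableEq Ω`; sequel to GEN-38's `…MergedForever` (merged runs stay merged, a.s.),
`…MeetingTimeTotal` (the total disagreement time `T = Σ_n 1{X_n ≠ X′_n}` of the common-random-numbers pair chain of
`K = indepMH q w` is an a.s. finite random variable; `P(T ≥ t) ≤ r^{t−1}·P(X_0 ≠ X′_0)`) and `…MeetingTimeMGF`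
(`E[s^{T_M}] ≤ 1 + (s − 1)·P(X_0 ≠ X′_0)/(1 − s r)` for the truncated counts `T_M`, uniformly in `M`; «NOT CLAIMED: the
`M = ∞` statement»).  `W = w(x₀)`, `A = 1/W`, `r = 1 − A`; `P̂_{μ̂₀}` the pair path law from the initial coupling `μ̂₀`.
Two spellings of `T` along a pair path `z`: the real one `Σ' 1{z_n ∉ Δ}` (as in `…MeetingTimeTotal`) and the ℕ-valued one
(the same `tsum` with the ℕ-valued indicator, used as an exponent); §1 shows they agree almost surely.

* §1 (pathwise ∕ a.s. bookkeeping) **`tsum_indicator_nat_eq_sum_of_merged`** — once merged for good, the ℕ-count is a finite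
  sum; **`crn_chain_ae_totalDisagreement_natCast`** — a.s. the two spellings of `T` agree; **`le_totalDisagreement_iff_of_merged_stay`**
  — along a path where merged runs stay merged, `T ≥ t ↔ z_{t−1} ∉ Δ` (`t ≥ 1`).
* §2 **`crn_chain_totalDisagreement_tail_eq`** — THE LAW OF `T` FROM EVERY INITIAL COUPLING: `P(T ≥ t) = P(X_{t−1} ≠ X′_{t−1})`
  EXACTLY (`t ≥ 1`) — the law of the meeting time IS the sequence of one-time disagreement probabilities (GEN-38 had `≤`);
  **`crn_chain_totalDisagreement_tail_eq_cold`** — from (cold, off-mode) with an atom-free proposal `P(T ≥ t) = r^{t−1}`: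
  `T` is GEOMETRIC with success probability `A` (GEN-38 had the two moments).
* §3 **`crn_chain_pow_totalDisagreement_integrable`**, **`crn_chain_integral_pow_totalDisagreement_le`** — THE `M = ∞`
  EXPONENTIAL MOMENTS: for `1 ≤ s` and `s r < 1`, `s^T` is integrable and `E[s^T] ≤ 1 + (s − 1)·P(X_0 ≠ X′_0)/(1 − s r)`
  from every initial coupling (Fatou along `T_M ↑ T` and `…MeetingTimeMGF`).
* §4 **`crn_chain_integral_pow_totalDisagreement_eq_cold`** — from (cold, off-mode): `E[s^T] = s·A/(1 − s r)` EXACTLY for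
  `1 ≤ s < 1/r` (monotone convergence) — the probability generating function of the geometric law.
Reading (gauge files): for two exact gauge samplers on one stream of random numbers the number of updates on which they
differ has `P(T ≥ t) = P(they still differ at update t − 1)`, every exponential moment of order `< log(1/(1 − A))` finite with
the displayed bound, and from (cold, hot) exactly the geometric law with parameter `A`.
NOT CLAIMED: `E[s^T]` for `s > 1/r` (infinite from (cold, off-mode)); the point masses `P(T = t)` typed separately (they are
differences of the displayed tails); two different proposals; any value of `A`.  No `sorry`, no new definitions, nothing cited
as a fact.
-/

noncomputable section

namespace Summit.Ventures.LatticeQCDFlow.Exactness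

open MeasureTheory ProbabilityTheory Function Finset Filter
open scoped ENNReal unitInterval Topology
open Summit.Ventures.LatticeQCDFlow.Scoring

variable {Ω : Type*} [MeasurableSpace Ω] {q : Measure Ω} [IsProbabilityMeasure q] {w : Ω → ℝ}

/-! ## §1 Pathwise and almost-sure bookkeeping -/

omit [MeasurableSpace Ω] in
/-- The ℕ-valued and the real disagreement indicators agree under the cast. [ours, bookkeeping] -/
theorem indicator_offDiagonal_natCast (p : Ω × Ω) :
    (((Set.diagonal Ω)ᶜ.indicator (1 : Ω × Ω → ℕ) p : ℕ) : ℝ) = (Set.diagonal Ω)ᶜ.indicator (1 : Ω × Ω → ℝ) p := by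
  by_cases hp : p ∈ (Set.diagonal Ω)ᶜ
  · rw [Set.indicator_of_mem hp, Set.indicator_of_mem hp, Pi.one_apply, Pi.one_apply, Nat.cast_one]
  · rw [Set.indicator_of_notMem hp, Set.indicator_of_notMem hp, Nat.cast_zero]

omit [MeasurableSpace Ω] in
/-- Pathwise: if the runs agree from time `n₀` on, then for every `M ≥ n₀` the ℕ-valued total count is the truncated count:
`Σ' 1{z_n ∉ Δ} = Σ_{n<M} 1{z_n ∉ Δ}`. [ours, bookkeeping] -/
theorem tsum_indicator_nat_eq_sum_of_merged {z : ℕ → Ω × Ω} {n₀ : ℕ} (hz : ∀ m, n₀ ≤ m → z m ∈ Set.diagonal Ω) {M : ℕ}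
    (hM : n₀ ≤ M) :
    ∑' n, (Set.diagonal Ω)ᶜ.indicator (1 : Ω × Ω → ℕ) (z n) = ∑ n ∈ Finset.range M, (Set.diagonal Ω)ᶜ.indicator (1 : Ω × Ω → ℕ) (z n) :=
  tsum_eq_sum fun n hn =>
    Set.indicator_of_notMem (show z n ∉ (Set.diagonal Ω)ᶜ from fun h =>
      h (hz n (hM.trans (Nat.le_of_not_lt fun h' => hn (Finset.mem_range.2 h'))))) _

omit [MeasurableSpace Ω] in
/-- Pathwise, real spelling: if the runs agree from time `n₀` on, then for every `M ≥ n₀`, `Σ' 1{z_n ∉ Δ} = Σ_{n<M} 1{z_n ∉ Δ}`.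
[ours, bookkeeping] -/
theorem tsum_indicator_real_eq_sum_of_merged {z : ℕ → Ω × Ω} {n₀ : ℕ} (hz : ∀ m, n₀ ≤ m → z m ∈ Set.diagonal Ω) {M : ℕ}
    (hM : n₀ ≤ M) :
    ∑' n, (Set.diagonal Ω)ᶜ.indicator (1 : Ω × Ω → ℝ) (z n) = ∑ n ∈ Finset.range M, (Set.diagonal Ω)ᶜ.indicator (1 : Ω × Ω → ℝ) (z n) :=
  tsum_eq_sum fun n hn =>
    Set.indicator_of_notMem (show z n ∉ (Set.diagonal Ω)ᶜ from fun h =>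
      h (hz n (hM.trans (Nat.le_of_not_lt fun h' => hn (Finset.mem_range.2 h'))))) _

/-- **ALMOST SURELY THE TWO SPELLINGS OF `T` AGREE**: `((Σ' 1{z_n ∉ Δ} : ℕ) : ℝ) = Σ' 1{z_n ∉ Δ}` on `P̂`-a.e. pair path
(`w` normalised, maximal at `x₀`). [ours, bookkeeping] -/
theorem crn_chain_ae_totalDisagreement_natCast [MeasurableEq Ω] (hw : Measurable w) (hw0 : ∀ y, 0 < w y) {x₀ : Ω}
    (hmax : ∀ y, w y ≤ w x₀) [IsProbabilityMeasure (q.withDensity fun y => ENNReal.ofReal (w y))]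
    (Khat : Kernel (Ω × Ω) (Ω × Ω)) [IsMarkovKernel Khat]
    (hK : ∀ z : Ω × Ω, Khat z = (q.prod (volume : Measure unitInterval)).map (fun p : Ω × unitInterval =>
      ((if (p.2 : ℝ) * w z.1 ≤ w p.1 then p.1 else z.1), (if (p.2 : ℝ) * w z.2 ≤ w p.1 then p.1 else z.2))))
    (μ₀ : Measure (Ω × Ω)) [IsProbabilityMeasure μ₀] :
    ∀ᵐ z ∂(Kernel.trajMeasure (X := fun _ : ℕ => Ω × Ω) μ₀
        (fun n : ℕ => Khat.comap (fun h : (i : ↥(Finset.Iic n)) → Ω × Ω => h ⟨n, Finset.mem_Iic.2 le_rfl⟩)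
          (measurable_pi_apply _))),
      ((∑' n, (Set.diagonal Ω)ᶜ.indicator (1 : Ω × Ω → ℕ) (z n) : ℕ) : ℝ) = ∑' n, (Set.diagonal Ω)ᶜ.indicator (1 : Ω × Ω → ℝ) (z n) := by
  filter_upwards [crn_chain_ae_eventually_merged hw hw0 hmax Khat hK μ₀] with z hz
  obtain ⟨n₀, hn₀⟩ := hz
  have hz' : ∀ m, n₀ ≤ m → z m ∈ Set.diagonal Ω := fun m hm => Set.mem_diagonal_iff.2 (hn₀ m hm)
  rw [tsum_indicator_nat_eq_sum_of_merged hz' le_rfl, tsum_indicator_real_eq_sum_of_merged hz' le_rfl, Nat.cast_sum]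
  exact Finset.sum_congr rfl fun n _ => indicator_offDiagonal_natCast (z n)

omit [MeasurableSpace Ω] in
/-- Pathwise: along a path where merged runs stay merged and which is merged from some time on, for `t ≥ 1`:
`t ≤ Σ' 1{z_n ∉ Δ} ↔ z_{t−1} ∉ Δ` — the total disagreement time is at least `t` exactly when the runs still differ at time
`t − 1`. [ours, bookkeeping] -/
theorem le_totalDisagreement_iff_of_merged_stay {z : ℕ → Ω × Ω}
    (hz : ∀ n m, n ≤ m → z n ∈ Set.diagonal Ω → z m ∈ Set.diagonal Ω)
    (hsum : Summable fun n => (Set.diagonal Ω)ᶜ.indicator (1 : Ω × Ω → ℝ) (z n)) {t : ℕ} (ht : 1 ≤ t) :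
    (t : ℝ) ≤ ∑' n, (Set.diagonal Ω)ᶜ.indicator (1 : Ω × Ω → ℝ) (z n) ↔ z (t - 1) ∉ Set.diagonal Ω := by
  constructor
  · intro hT hmem
    -- every indicator with index `≥ t − 1` vanishes: the `tsum` is a sum over `range (t − 1)`, at most `t − 1`
    have hts := tsum_indicator_real_eq_sum_of_merged (n₀ := t - 1) (fun m hm => hz (t - 1) m hm hmem) le_rfl
    have hle : ∑ n ∈ Finset.range (t - 1), (Set.diagonal Ω)ᶜ.indicator (1 : Ω × Ω → ℝ) (z n) ≤ (t - 1 : ℕ) :=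
      calc ∑ n ∈ Finset.range (t - 1), (Set.diagonal Ω)ᶜ.indicator (1 : Ω × Ω → ℝ) (z n)
          ≤ ∑ n ∈ Finset.range (t - 1), (1 : ℝ) := sum_le_sum fun n _ => Set.indicator_le_self' (fun _ _ => zero_le_one) _
        _ = (t - 1 : ℕ) := by rw [sum_const, card_range, nsmul_eq_mul, mul_one]
    have hcast : ((t - 1 : ℕ) : ℝ) = (t : ℝ) - 1 := by rw [Nat.cast_sub ht, Nat.cast_one]
    rw [hts] at hT
    linarith
  · intro hoff
    -- every earlier time is off the diagonal too, so the first `t` indicators are all `1`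
    have hall : ∀ n, n < t → z n ∉ Set.diagonal Ω := fun n hn h => hoff (hz n (t - 1) (Nat.le_sub_one_of_lt hn) h)
    have hsumt : ∑ n ∈ Finset.range t, (Set.diagonal Ω)ᶜ.indicator (1 : Ω × Ω → ℝ) (z n) = t := by
      rw [Finset.sum_congr rfl fun n hn => (by
        rw [Set.indicator_of_mem (show z n ∈ (Set.diagonal Ω)ᶜ from hall n (Finset.mem_range.1 hn)), Pi.one_apply] :
          (Set.diagonal Ω)ᶜ.indicator (1 : Ω × Ω → ℝ) (z n) = 1), sum_const, card_range, nsmul_eq_mul, mul_one]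
    rw [← hsumt]
    exact hsum.sum_le_tsum (Finset.range t) fun n _ => Set.indicator_nonneg (fun _ _ => zero_le_one) _

/-! ## §2 The law of the total disagreement time from every initial coupling -/

/-- **`P(T ≥ t) = P(X_{t−1} ≠ X′_{t−1})` EXACTLY** for every `t ≥ 1`, from every initial coupling (`w` normalised, maximal at
`x₀`): the law of the meeting time is the sequence of one-time disagreement probabilities of the pair chain. [ours] -/
theorem crn_chain_totalDisagreement_tail_eq [MeasurableEq Ω] (hw : Measurable w) (hw0 : ∀ y, 0 < w y) {x₀ : Ω}
    (hmax : ∀ y, w y ≤ w x₀) [IsProbabilityMeasure (q.withDensity fun y => ENNReal.ofReal (w y))]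
    (Khat : Kernel (Ω × Ω) (Ω × Ω)) [IsMarkovKernel Khat]
    (hK : ∀ z : Ω × Ω, Khat z = (q.prod (volume : Measure unitInterval)).map (fun p : Ω × unitInterval =>
      ((if (p.2 : ℝ) * w z.1 ≤ w p.1 then p.1 else z.1), (if (p.2 : ℝ) * w z.2 ≤ w p.1 then p.1 else z.2))))
    (μ₀ : Measure (Ω × Ω)) [IsProbabilityMeasure μ₀] {t : ℕ} (ht : 1 ≤ t) :
    (Kernel.trajMeasure (X := fun _ : ℕ => Ω × Ω) μ₀
          (fun n : ℕ => Khat.comap (fun h : (i : ↥(Finset.Iic n)) → Ω × Ω => h ⟨n, Finset.mem_Iic.2 le_rfl⟩)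
            (measurable_pi_apply _))).real
        {z | (t : ℝ) ≤ ∑' n, (Set.diagonal Ω)ᶜ.indicator (1 : Ω × Ω → ℝ) (z n)} =
      ((fun m : Measure (Ω × Ω) => m.bind Khat)^[t - 1] μ₀).real (Set.diagonal Ω)ᶜ := by
  set P := Kernel.trajMeasure (X := fun _ : ℕ => Ω × Ω) μ₀
      (fun n : ℕ => Khat.comap (fun h : (i : ↥(Finset.Iic n)) → Ω × Ω => h ⟨n, Finset.mem_Iic.2 le_rfl⟩)
        (measurable_pi_apply _)) with hP
  have hae : {z : ℕ → Ω × Ω | (t : ℝ) ≤ ∑' n, (Set.diagonal Ω)ᶜ.indicator (1 : Ω × Ω → ℝ) (z n)} =ᵐ[P]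
      {z | z (t - 1) ∉ Set.diagonal Ω} := by
    filter_upwards [crn_chain_ae_merged_stay hw hw0 Khat hK μ₀, crn_chain_ae_summable_disagreement hw hw0 hmax Khat hK μ₀]
      with z hz hsumz
    exact propext (le_totalDisagreement_iff_of_merged_stay hz hsumz.2 ht)
  rw [measureReal_congr hae, hP]
  exact crn_chain_offDiagonal_real_eq Khat μ₀ (t - 1)

/-- **`T` IS GEOMETRIC FROM (COLD, OFF-MODE)**: first run at the mode `x₀`, second run never at the mode, atom-free proposal
(`q{x₀} = 0`) ⇒ `P(T ≥ t) = r^{t−1}` EXACTLY for every `t ≥ 1` (`r = 1 − 1/w(x₀)`). [ours] -/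
theorem crn_chain_totalDisagreement_tail_eq_cold [MeasurableSingletonClass Ω] [MeasurableEq Ω] (hw : Measurable w)
    (hw0 : ∀ y, 0 < w y) {x₀ : Ω} (hmax : ∀ y, w y ≤ w x₀) [IsProbabilityMeasure (q.withDensity fun y => ENNReal.ofReal (w y))]
    (hq0 : q {x₀} = 0) (Khat : Kernel (Ω × Ω) (Ω × Ω)) [IsMarkovKernel Khat]
    (hK : ∀ z : Ω × Ω, Khat z = (q.prod (volume : Measure unitInterval)).map (fun p : Ω × unitInterval =>
      ((if (p.2 : ℝ) * w z.1 ≤ w p.1 then p.1 else z.1), (if (p.2 : ℝ) * w z.2 ≤ w p.1 then p.1 else z.2))))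
    (μ₀ : Measure (Ω × Ω)) [IsProbabilityMeasure μ₀] (hfst : μ₀.map Prod.fst = Measure.dirac x₀)
    (hsnd : (μ₀.map Prod.snd) {x₀} = 0) {t : ℕ} (ht : 1 ≤ t) :
    (Kernel.trajMeasure (X := fun _ : ℕ => Ω × Ω) μ₀
          (fun n : ℕ => Khat.comap (fun h : (i : ↥(Finset.Iic n)) → Ω × Ω => h ⟨n, Finset.mem_Iic.2 le_rfl⟩)
            (measurable_pi_apply _))).real
        {z | (t : ℝ) ≤ ∑' n, (Set.diagonal Ω)ᶜ.indicator (1 : Ω × Ω → ℝ) (z n)} = (1 - (w x₀)⁻¹) ^ (t - 1) := by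
  rw [crn_chain_totalDisagreement_tail_eq hw hw0 hmax Khat hK μ₀ ht]
  exact iterate_bind_crnPair_offDiagonal_eq hw hw0 hmax hq0 Khat hK (t - 1) μ₀ hfst hsnd

/-! ## §3 The `M = ∞` exponential moments from every initial coupling -/

/-- **`∫⁻ s^T ≤ 1 + (s − 1)·P(X_0 ≠ X′_0)/(1 − s r)`** (extended-real form; Fatou along the truncated counts) for `1 ≤ s` and
`s r < 1`, from every initial coupling. [ours] -/
theorem crn_chain_lintegral_pow_totalDisagreement_le [MeasurableEq Ω] (hw : Measurable w) (hw0 : ∀ y, 0 < w y) {x₀ : Ω}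
    (hmax : ∀ y, w y ≤ w x₀) [IsProbabilityMeasure (q.withDensity fun y => ENNReal.ofReal (w y))]
    (Khat : Kernel (Ω × Ω) (Ω × Ω)) [IsMarkovKernel Khat]
    (hK : ∀ z : Ω × Ω, Khat z = (q.prod (volume : Measure unitInterval)).map (fun p : Ω × unitInterval =>
      ((if (p.2 : ℝ) * w z.1 ≤ w p.1 then p.1 else z.1), (if (p.2 : ℝ) * w z.2 ≤ w p.1 then p.1 else z.2))))
    (μ₀ : Measure (Ω × Ω)) [IsProbabilityMeasure μ₀] {s : ℝ} (hs : 1 ≤ s) (hsr : s * (1 - (w x₀)⁻¹) < 1) :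
    ∫⁻ z, ENNReal.ofReal (s ^ (∑' n, (Set.diagonal Ω)ᶜ.indicator (1 : Ω × Ω → ℕ) (z n)))
        ∂(Kernel.trajMeasure (X := fun _ : ℕ => Ω × Ω) μ₀
          (fun n : ℕ => Khat.comap (fun h : (i : ↥(Finset.Iic n)) → Ω × Ω => h ⟨n, Finset.mem_Iic.2 le_rfl⟩)
            (measurable_pi_apply _))) ≤
      ENNReal.ofReal (1 + (s - 1) * (μ₀.real (Set.diagonal Ω)ᶜ / (1 - s * (1 - (w x₀)⁻¹)))) := by
  set P := Kernel.trajMeasure (X := fun _ : ℕ => Ω × Ω) μ₀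
      (fun n : ℕ => Khat.comap (fun h : (i : ↥(Finset.Iic n)) → Ω × Ω => h ⟨n, Finset.mem_Iic.2 le_rfl⟩)
        (measurable_pi_apply _)) with hP
  have hs0 : 0 ≤ s := zero_le_one.trans hs
  have hD : MeasurableSet (Set.diagonal Ω) := measurableSet_diagonal
  have hIm : Measurable ((Set.diagonal Ω)ᶜ.indicator (1 : Ω × Ω → ℝ)) := measurable_one.indicator hD.compl
  -- the measurable real spelling of `s^{T_M}` along merged-stay paths
  set g : ℕ → (ℕ → Ω × Ω) → ℝ := fun M z =>
    1 + (s - 1) * ∑ n ∈ Finset.range M, s ^ n * (Set.diagonal Ω)ᶜ.indicator (1 : Ω × Ω → ℝ) (z n) with hg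
  have hgm : ∀ M, Measurable (g M) := fun M =>
    measurable_const.add ((Finset.measurable_sum _ fun n _ => (hIm.comp (measurable_pi_apply n)).const_mul _).const_mul _)
  have hg_eq : ∀ᵐ z ∂P, ∀ M, g M z = s ^ (∑ n ∈ Finset.range M, (Set.diagonal Ω)ᶜ.indicator (1 : Ω × Ω → ℕ) (z n)) := by
    filter_upwards [crn_chain_ae_merged_stay hw hw0 Khat hK μ₀] with z hz
    exact fun M => (pow_disagreementCount_eq hz s M).symm
  have hIb : ∀ p : Ω × Ω, |(Set.diagonal Ω)ᶜ.indicator (1 : Ω × Ω → ℝ) p| ≤ 1 := by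
    intro p
    by_cases hp : p ∈ (Set.diagonal Ω)ᶜ
    · rw [Set.indicator_of_mem hp, Pi.one_apply, abs_one]
    · rw [Set.indicator_of_notMem hp, abs_zero]; exact zero_le_one
  have hgi : ∀ M, Integrable (g M) P := fun M =>
    (integrable_const _).add ((integrable_finsetSum _ fun n _ =>
      (integrable_of_bounded P (hIm.comp (measurable_pi_apply n)) (fun z => hIb _)).const_mul _).const_mul _)
  have hg_nonneg : ∀ᵐ z ∂P, ∀ M, 0 ≤ g M z := by
    filter_upwards [hg_eq] with z hz
    exact fun M => by rw [hz M]; exact pow_nonneg hs0 _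
  have hbound : ∀ M, ∫ z, g M z ∂P ≤ 1 + (s - 1) * (μ₀.real (Set.diagonal Ω)ᶜ / (1 - s * (1 - (w x₀)⁻¹))) := by
    intro M
    rw [integral_congr_ae (hg_eq.mono fun z hz => hz M), hP]
    exact crn_chain_integral_pow_disagreementCount_le_of_lt hw hw0 hmax Khat hK μ₀ hs hsr M
  -- a.e. the truncated counts are eventually the total count, so `g_M → s^T`
  have hae : ∀ᵐ z ∂P, ENNReal.ofReal (s ^ (∑' n, (Set.diagonal Ω)ᶜ.indicator (1 : Ω × Ω → ℕ) (z n))) =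
      liminf (fun M => ENNReal.ofReal (g M z)) atTop := by
    filter_upwards [hg_eq, crn_chain_ae_eventually_merged hw hw0 hmax Khat hK μ₀] with z hz hmerged
    obtain ⟨n₀, hn₀⟩ := hmerged
    have hz' : ∀ m, n₀ ≤ m → z m ∈ Set.diagonal Ω := fun m hm => Set.mem_diagonal_iff.2 (hn₀ m hm)
    have htend : Tendsto (fun M => ENNReal.ofReal (g M z)) atTop
        (𝓝 (ENNReal.ofReal (s ^ (∑' n, (Set.diagonal Ω)ᶜ.indicator (1 : Ω × Ω → ℕ) (z n))))) :=
      tendsto_const_nhds.congr' (eventually_atTop.2 ⟨n₀, fun M hM => by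
        show ENNReal.ofReal (s ^ (∑' n, (Set.diagonal Ω)ᶜ.indicator (1 : Ω × Ω → ℕ) (z n))) = ENNReal.ofReal (g M z)
        rw [hz M, tsum_indicator_nat_eq_sum_of_merged hz' hM]⟩)
    exact htend.liminf_eq.symm
  rw [lintegral_congr_ae hae]
  refine (lintegral_liminf_le fun M => ENNReal.measurable_ofReal.comp (hgm M)).trans ?_
  refine liminf_le_of_frequently_le' (Frequently.of_forall fun M => ?_)
  show ∫⁻ z, ENNReal.ofReal (g M z) ∂P ≤ _
  rw [← ofReal_integral_eq_lintegral_ofReal (hgi M) (hg_nonneg.mono fun z hz => hz M)]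
  exact ENNReal.ofReal_le_ofReal (hbound M)

/-- **`s^T` IS INTEGRABLE** for `1 ≤ s` and `s r < 1`, from every initial coupling: every exponential moment of the meeting time of
order `< log(1/r)` is finite. [ours] -/
theorem crn_chain_pow_totalDisagreement_integrable [MeasurableEq Ω] (hw : Measurable w) (hw0 : ∀ y, 0 < w y) {x₀ : Ω}
    (hmax : ∀ y, w y ≤ w x₀) [IsProbabilityMeasure (q.withDensity fun y => ENNReal.ofReal (w y))]
    (Khat : Kernel (Ω × Ω) (Ω × Ω)) [IsMarkovKernel Khat]
    (hK : ∀ z : Ω × Ω, Khat z = (q.prod (volume : Measure unitInterval)).map (fun p : Ω × unitInterval =>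
      ((if (p.2 : ℝ) * w z.1 ≤ w p.1 then p.1 else z.1), (if (p.2 : ℝ) * w z.2 ≤ w p.1 then p.1 else z.2))))
    (μ₀ : Measure (Ω × Ω)) [IsProbabilityMeasure μ₀] {s : ℝ} (hs : 1 ≤ s) (hsr : s * (1 - (w x₀)⁻¹) < 1) :
    Integrable (fun z : ℕ → Ω × Ω => s ^ (∑' n, (Set.diagonal Ω)ᶜ.indicator (1 : Ω × Ω → ℕ) (z n)))
      (Kernel.trajMeasure (X := fun _ : ℕ => Ω × Ω) μ₀
        (fun n : ℕ => Khat.comap (fun h : (i : ↥(Finset.Iic n)) → Ω × Ω => h ⟨n, Finset.mem_Iic.2 le_rfl⟩)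
          (measurable_pi_apply _))) := by
  set P := Kernel.trajMeasure (X := fun _ : ℕ => Ω × Ω) μ₀
      (fun n : ℕ => Khat.comap (fun h : (i : ↥(Finset.Iic n)) → Ω × Ω => h ⟨n, Finset.mem_Iic.2 le_rfl⟩)
        (measurable_pi_apply _)) with hP
  have hs0 : 0 ≤ s := zero_le_one.trans hs
  have hD : MeasurableSet (Set.diagonal Ω) := measurableSet_diagonal
  have hIm : Measurable ((Set.diagonal Ω)ᶜ.indicator (1 : Ω × Ω → ℝ)) := measurable_one.indicator hD.compl
  set g : ℕ → (ℕ → Ω × Ω) → ℝ := fun M z =>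
    1 + (s - 1) * ∑ n ∈ Finset.range M, s ^ n * (Set.diagonal Ω)ᶜ.indicator (1 : Ω × Ω → ℝ) (z n) with hg
  have hgm : ∀ M, Measurable (g M) := fun M =>
    measurable_const.add ((Finset.measurable_sum _ fun n _ => (hIm.comp (measurable_pi_apply n)).const_mul _).const_mul _)
  -- a.e.-strong measurability of `s^T` as the a.e. limit of the measurable `g_M`
  have hasm : AEStronglyMeasurable (fun z : ℕ → Ω × Ω => s ^ (∑' n, (Set.diagonal Ω)ᶜ.indicator (1 : Ω × Ω → ℕ) (z n))) P := by
    refine aestronglyMeasurable_of_tendsto_ae atTop (fun M => (hgm M).aestronglyMeasurable) ?_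
    filter_upwards [crn_chain_ae_merged_stay hw hw0 Khat hK μ₀, crn_chain_ae_eventually_merged hw hw0 hmax Khat hK μ₀]
      with z hz hmerged
    obtain ⟨n₀, hn₀⟩ := hmerged
    have hz' : ∀ m, n₀ ≤ m → z m ∈ Set.diagonal Ω := fun m hm => Set.mem_diagonal_iff.2 (hn₀ m hm)
    exact tendsto_const_nhds.congr' (eventually_atTop.2 ⟨n₀, fun M hM => by
      show s ^ (∑' n, (Set.diagonal Ω)ᶜ.indicator (1 : Ω × Ω → ℕ) (z n)) = g M z
      rw [hg]; dsimp only
      rw [← pow_disagreementCount_eq hz s M, tsum_indicator_nat_eq_sum_of_merged hz' hM]⟩)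
  refine ⟨hasm, ?_⟩
  rw [hasFiniteIntegral_iff_ofReal (ae_of_all _ fun z => pow_nonneg hs0 _)]
  exact (crn_chain_lintegral_pow_totalDisagreement_le hw hw0 hmax Khat hK μ₀ hs hsr).trans_lt ENNReal.ofReal_lt_top

/-- **THE `M = ∞` EXPONENTIAL MOMENTS: `E[s^T] ≤ 1 + (s − 1)·P(X_0 ≠ X′_0)/(1 − s r)`** for `1 ≤ s` and `s r < 1`, from every
initial coupling (`w` normalised, maximal at `x₀`, `r = 1 − 1/w(x₀)`). [ours] -/
theorem crn_chain_integral_pow_totalDisagreement_le [MeasurableEq Ω] (hw : Measurable w) (hw0 : ∀ y, 0 < w y) {x₀ : Ω}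
    (hmax : ∀ y, w y ≤ w x₀) [IsProbabilityMeasure (q.withDensity fun y => ENNReal.ofReal (w y))]
    (Khat : Kernel (Ω × Ω) (Ω × Ω)) [IsMarkovKernel Khat]
    (hK : ∀ z : Ω × Ω, Khat z = (q.prod (volume : Measure unitInterval)).map (fun p : Ω × unitInterval =>
      ((if (p.2 : ℝ) * w z.1 ≤ w p.1 then p.1 else z.1), (if (p.2 : ℝ) * w z.2 ≤ w p.1 then p.1 else z.2))))
    (μ₀ : Measure (Ω × Ω)) [IsProbabilityMeasure μ₀] {s : ℝ} (hs : 1 ≤ s) (hsr : s * (1 - (w x₀)⁻¹) < 1) :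
    ∫ z, s ^ (∑' n, (Set.diagonal Ω)ᶜ.indicator (1 : Ω × Ω → ℕ) (z n))
        ∂(Kernel.trajMeasure (X := fun _ : ℕ => Ω × Ω) μ₀
          (fun n : ℕ => Khat.comap (fun h : (i : ↥(Finset.Iic n)) → Ω × Ω => h ⟨n, Finset.mem_Iic.2 le_rfl⟩)
            (measurable_pi_apply _))) ≤
      1 + (s - 1) * (μ₀.real (Set.diagonal Ω)ᶜ / (1 - s * (1 - (w x₀)⁻¹))) := by
  have hs0 : 0 ≤ s := zero_le_one.trans hs
  have hW : 1 ≤ w x₀ := one_le_of_mode (q := q) hmax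
  have hr0 : 0 ≤ 1 - (w x₀)⁻¹ := sub_nonneg.2 (inv_le_one_of_one_le₀ hW)
  have hB0 : 0 ≤ 1 + (s - 1) * (μ₀.real (Set.diagonal Ω)ᶜ / (1 - s * (1 - (w x₀)⁻¹))) :=
    add_nonneg zero_le_one (mul_nonneg (sub_nonneg.2 hs) (div_nonneg measureReal_nonneg (sub_nonneg.2 hsr.le)))
  have hI := crn_chain_pow_totalDisagreement_integrable hw hw0 hmax Khat hK μ₀ hs hsr
  have hL := crn_chain_lintegral_pow_totalDisagreement_le hw hw0 hmax Khat hK μ₀ hs hsr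
  rw [integral_eq_lintegral_of_nonneg_ae (ae_of_all _ fun z => pow_nonneg hs0 _) hI.aestronglyMeasurable]
  exact (ENNReal.toReal_mono ENNReal.ofReal_ne_top hL).trans_eq (ENNReal.toReal_ofReal hB0)

/-! ## §4 From (cold, off-mode): the probability generating function of the geometric law, exactly -/

/-- **`E[s^T] = s·A/(1 − s r)` EXACTLY** from the coupling (first run at the mode `x₀`, second run never at the mode), atom-free
proposal (`q{x₀} = 0`), for `1 ≤ s` and `s r < 1` (`A = 1/w(x₀)`, `r = 1 − A`; monotone convergence along `T_M ↑ T` and the exact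
truncated moments of `…MeetingTimeMGF`) — the probability generating function of the geometric law with parameter `A`. [ours] -/
theorem crn_chain_integral_pow_totalDisagreement_eq_cold [MeasurableSingletonClass Ω] [MeasurableEq Ω] (hw : Measurable w)
    (hw0 : ∀ y, 0 < w y) {x₀ : Ω} (hmax : ∀ y, w y ≤ w x₀) [IsProbabilityMeasure (q.withDensity fun y => ENNReal.ofReal (w y))]
    (hq0 : q {x₀} = 0) (Khat : Kernel (Ω × Ω) (Ω × Ω)) [IsMarkovKernel Khat]
    (hK : ∀ z : Ω × Ω, Khat z = (q.prod (volume : Measure unitInterval)).map (fun p : Ω × unitInterval =>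
      ((if (p.2 : ℝ) * w z.1 ≤ w p.1 then p.1 else z.1), (if (p.2 : ℝ) * w z.2 ≤ w p.1 then p.1 else z.2))))
    (μ₀ : Measure (Ω × Ω)) [IsProbabilityMeasure μ₀] (hfst : μ₀.map Prod.fst = Measure.dirac x₀)
    (hsnd : (μ₀.map Prod.snd) {x₀} = 0) {s : ℝ} (hs : 1 ≤ s) (hsr : s * (1 - (w x₀)⁻¹) < 1) :
    ∫ z, s ^ (∑' n, (Set.diagonal Ω)ᶜ.indicator (1 : Ω × Ω → ℕ) (z n))
        ∂(Kernel.trajMeasure (X := fun _ : ℕ => Ω × Ω) μ₀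
          (fun n : ℕ => Khat.comap (fun h : (i : ↥(Finset.Iic n)) → Ω × Ω => h ⟨n, Finset.mem_Iic.2 le_rfl⟩)
            (measurable_pi_apply _))) = s * (w x₀)⁻¹ / (1 - s * (1 - (w x₀)⁻¹)) := by
  set P := Kernel.trajMeasure (X := fun _ : ℕ => Ω × Ω) μ₀
      (fun n : ℕ => Khat.comap (fun h : (i : ↥(Finset.Iic n)) → Ω × Ω => h ⟨n, Finset.mem_Iic.2 le_rfl⟩)
        (measurable_pi_apply _)) with hP
  have hs0 : 0 ≤ s := zero_le_one.trans hs
  have hW : 1 ≤ w x₀ := one_le_of_mode (q := q) hmax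
  have hr0 : 0 ≤ 1 - (w x₀)⁻¹ := sub_nonneg.2 (inv_le_one_of_one_le₀ hW)
  have hsr0 : 0 ≤ s * (1 - (w x₀)⁻¹) := mul_nonneg hs0 hr0
  have hD : MeasurableSet (Set.diagonal Ω) := measurableSet_diagonal
  have hIm : Measurable ((Set.diagonal Ω)ᶜ.indicator (1 : Ω × Ω → ℝ)) := measurable_one.indicator hD.compl
  set g : ℕ → (ℕ → Ω × Ω) → ℝ := fun M z =>
    1 + (s - 1) * ∑ n ∈ Finset.range M, s ^ n * (Set.diagonal Ω)ᶜ.indicator (1 : Ω × Ω → ℝ) (z n) with hg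
  have hg_eq : ∀ᵐ z ∂P, ∀ M, g M z = s ^ (∑ n ∈ Finset.range M, (Set.diagonal Ω)ᶜ.indicator (1 : Ω × Ω → ℕ) (z n)) := by
    filter_upwards [crn_chain_ae_merged_stay hw hw0 Khat hK μ₀] with z hz
    exact fun M => (pow_disagreementCount_eq hz s M).symm
  have hIb : ∀ p : Ω × Ω, |(Set.diagonal Ω)ᶜ.indicator (1 : Ω × Ω → ℝ) p| ≤ 1 := by
    intro p
    by_cases hp : p ∈ (Set.diagonal Ω)ᶜ
    · rw [Set.indicator_of_mem hp, Pi.one_apply, abs_one]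
    · rw [Set.indicator_of_notMem hp, abs_zero]; exact zero_le_one
  have hgi : ∀ M, Integrable (g M) P := fun M =>
    (integrable_const _).add ((integrable_finsetSum _ fun n _ =>
      (integrable_of_bounded P (hIm.comp (measurable_pi_apply n)) (fun z => hIb _)).const_mul _).const_mul _)
  have hI := crn_chain_pow_totalDisagreement_integrable hw hw0 hmax Khat hK μ₀ hs hsr
  rw [← hP] at hI
  -- monotone in `M` (the counts increase, `s ≥ 1`) and convergent to `s^T` along a.e. path
  have hmono : ∀ᵐ z ∂P, Monotone fun M => g M z := by
    filter_upwards [hg_eq] with z hz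
    intro M M' hMM'
    show g M z ≤ g M' z
    rw [hz M, hz M']
    refine pow_le_pow_right₀ hs (Finset.sum_le_sum_of_subset_of_nonneg (Finset.range_mono hMM') fun n _ _ => ?_)
    exact Nat.zero_le _
  have htend : ∀ᵐ z ∂P, Tendsto (fun M => g M z) atTop
      (𝓝 (s ^ (∑' n, (Set.diagonal Ω)ᶜ.indicator (1 : Ω × Ω → ℕ) (z n)))) := by
    filter_upwards [hg_eq, crn_chain_ae_eventually_merged hw hw0 hmax Khat hK μ₀] with z hz hmerged
    obtain ⟨n₀, hn₀⟩ := hmerged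
    have hz' : ∀ m, n₀ ≤ m → z m ∈ Set.diagonal Ω := fun m hm => Set.mem_diagonal_iff.2 (hn₀ m hm)
    exact tendsto_const_nhds.congr' (eventually_atTop.2 ⟨n₀, fun M hM => by
      show s ^ (∑' n, (Set.diagonal Ω)ᶜ.indicator (1 : Ω × Ω → ℕ) (z n)) = g M z
      rw [hz M, tsum_indicator_nat_eq_sum_of_merged hz' hM]⟩)
  have hlim := integral_tendsto_of_tendsto_of_monotone hgi hI hmono htend
  -- the truncated moments are `1 + (s − 1)·Σ_{n<M}(s r)ⁿ → 1 + (s − 1)/(1 − s r)`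
  have hval : ∀ M, ∫ z, g M z ∂P = 1 + (s - 1) * ∑ n ∈ Finset.range M, (s * (1 - (w x₀)⁻¹)) ^ n := by
    intro M
    rw [integral_congr_ae (hg_eq.mono fun z hz => hz M), hP]
    exact crn_chain_integral_pow_disagreementCount_eq_cold hw hw0 hmax hq0 Khat hK μ₀ hfst hsnd s M
  have hlim' : Tendsto (fun M => ∫ z, g M z ∂P) atTop (𝓝 (1 + (s - 1) * (1 - s * (1 - (w x₀)⁻¹))⁻¹)) := by
    simp_rw [hval]
    exact tendsto_const_nhds.add (((hasSum_geometric_of_lt_one hsr0 hsr).tendsto_sum_nat).const_mul _)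
  have hval' : 1 + (s - 1) * (1 - s * (1 - (w x₀)⁻¹))⁻¹ = s * (w x₀)⁻¹ / (1 - s * (1 - (w x₀)⁻¹)) := by
    have hne : 1 - s * (1 - (w x₀)⁻¹) ≠ 0 := (sub_pos.2 hsr).ne'
    rw [eq_div_iff hne, add_mul, mul_assoc, inv_mul_cancel₀ hne, mul_one, one_mul]
    ring
  rw [← hval']
  exact tendsto_nhds_unique hlim hlim'

end Summit.Ventures.LatticeQCDFlow.Exactness

end
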